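import Literature.AlgebraicGeometry.HodgeTheory.SymmetricA3ReducedFunctionJets
import Literature.AlgebraicGeometry.HodgeTheory.SymmetricA3ChartNodes
import HarnessLib

/-!
# Singular points of the members of the symmetric `A₃` unfolding versus critical zeros of the reduced function
# (programme B2-BIF, bridge for the assembly S7)

Family `hodge`, layer `Literature/AlgebraicGeometry/HodgeTheory`, sequel of `SymmetricA3ReducedFunctionJets` and
`SymmetricA3ChartNodes`, hypotheses in the shape of the conjuncts of `IsSymmetricA3Datum.exists_reducedChart`.  Written by
the prover seat `hodge-nonav-19716-p2` (g8, cell `hodge-nonav`) for the assembly of `IsSymmetricA3Bifurcation` (binder hB2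
`picardLefschetz_symmetricA3` of crux K1-B of `Summits/HodgeConjecture/HodgeConjecture/Theses/SignSymmetricPowers.lean`,
stmt-HodgeConjecture-19716; AGZV II §5.2).

In the chart `x_j = 1` near `e_j`, a point `x` is a SINGULAR point of the member `F_μ = f₁ + α g₂ + β g₀` (all partials
vanish) iff `x = xs(μ, u)` with `u = x_k` a CRITICAL ZERO of the reduced function `r(μ, ·)` (`r = 0 = ∂ᵤr`):

* `critical_of_singular` — a singular `x` with `x_j = 1` in the uniqueness box gives `(μ, x_k) ∈ D`, `xs(μ, x_k) = x`,
  `r(μ, x_k) = 0`, `∂ᵤr(μ, x_k) = 0` (uniqueness clause + `slice_singular_iff` + `∂ᵤr = ∂ₖF∘xs`);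
* `singular_of_critical` — conversely a critical zero `u` of `r(μ, ·)` with `(μ, u) ∈ D` gives a singular point
  `xs(μ, u) ≠ 0` of `F_μ`;
* `isOrdinaryDoublePointOf_of_critical` — if moreover `∂ᵤ²r(μ, u) ≠ 0` and the Hessian block is non-degenerate, the
  singular point is an ordinary double point (`isOrdinaryDoublePointOf_chart`).

## References
* [ArnoldGuseinzadeVarchenko2012] AGZV II, Part I §5.2 (pp. 132–133 of the held text).
* [VoisinHodgeII2003] Voisin II, §2.1.1 Lemma 2.7, §2.3.1.
-/

noncomputable section

open MvPolynomial Metric Set Filter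
open scoped Topology
open Literature.AlgebraicGeometry.Motives

namespace Literature.AlgebraicGeometry.HodgeTheory

open DiscriminantBranches

section HodgeTheory

variable {n d : ℕ} {f₁ g₀ g₂ : MvPolynomial (Fin (n + 2)) ℂ} {j k : Fin (n + 2)} {a : Fin (n + 2) → ℂˣ}
  {D : Set ((ℂ × ℂ) × ℂ)} {xs : (ℂ × ℂ) × ℂ → (Fin (n + 2) → ℂ)} {s : (ℂ × ℂ) × ℂ → ℂ}

namespace IsSymmetricA3Datum

/-- **Singular point in the box ⟹ critical zero of the reduced function.**  Let `μ` and `x` lie in the uniqueness box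
of the reduced chart (`‖μ‖ < ρ`, `‖x − e_j‖ < ρ`), `x_j = 1`, and let all partials of `F_μ = f₁ + α g₂ + β g₀` vanish at
`x`.  Then `(μ, x_k) ∈ D`, `xs(μ, x_k) = x`, `r(μ, x_k) = F_μ(x) = 0` and `∂ᵤr(μ, x_k) = 0`.
[cite: ArnoldGuseinzadeVarchenko2012, Part I §5.2] [cite: VoisinHodgeII2003, §2.1.1 Lemma 2.7] -/
theorem critical_of_singular (hf₁ : f₁.IsHomogeneous d) (hg₀ : g₀.IsHomogeneous d) (hg₂ : g₂.IsHomogeneous d)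
    (hD : IsSymmetricA3Datum f₁ g₀ g₂ j k a)
    (hks : ∀ p ∈ D, eval (xs p) (pderiv k (f₁ + p.1.1 • g₂ + p.1.2 • g₀)) = p.2 * s p)
    (hgrad : ∀ p ∈ D, HasFDerivAt (fun q : (ℂ × ℂ) × ℂ => eval (xs q) (f₁ + q.1.1 • g₂ + q.1.2 • g₀))
      (eval (xs p) g₂ • (ContinuousLinearMap.fst ℂ ℂ ℂ).comp (ContinuousLinearMap.fst ℂ (ℂ × ℂ) ℂ) +
        eval (xs p) g₀ • (ContinuousLinearMap.snd ℂ ℂ ℂ).comp (ContinuousLinearMap.fst ℂ (ℂ × ℂ) ℂ) +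
        (p.2 * s p) • ContinuousLinearMap.snd ℂ (ℂ × ℂ) ℂ) p)
    {ρ : ℝ} (huniq : ∀ (μ : ℂ × ℂ) (x : Fin (n + 2) → ℂ), ‖μ‖ < ρ → ‖x - Pi.single j 1‖ < ρ → x j = 1 →
      (∀ i, i ≠ j → i ≠ k → eval x (pderiv i (f₁ + μ.1 • g₂ + μ.2 • g₀)) = 0) → (μ, x k) ∈ D ∧ xs (μ, x k) = x)
    {μ : ℂ × ℂ} {x : Fin (n + 2) → ℂ} (hμ : ‖μ‖ < ρ) (hx : ‖x - Pi.single j 1‖ < ρ) (hxj : x j = 1)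
    (hsing : ∀ i, eval x (pderiv i (f₁ + μ.1 • g₂ + μ.2 • g₀)) = 0) :
    (μ, x k) ∈ D ∧ xs (μ, x k) = x ∧ eval (xs (μ, x k)) (f₁ + μ.1 • g₂ + μ.2 • g₀) = 0 ∧
      deriv (fun v => eval (xs (μ, v)) (f₁ + μ.1 • g₂ + μ.2 • g₀)) (x k) = 0 := by
  have hF : (f₁ + μ.1 • g₂ + μ.2 • g₀).IsHomogeneous d := by
    rw [MvPolynomial.smul_eq_C_mul, MvPolynomial.smul_eq_C_mul]
    exact (hf₁.add (hg₂.C_mul _)).add (hg₀.C_mul _)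
  have hd : d ≠ 0 := by have := hD.one_le hf₁; omega
  obtain ⟨hmem, hxs⟩ := huniq μ x hμ hx hxj (fun i _ _ => hsing i)
  obtain ⟨hzero, hk⟩ := (slice_singular_iff hF hd hD.1 hxj (fun i _ _ => hsing i)).1 hsing
  refine ⟨hmem, hxs, by rw [hxs]; exact hzero, ?_⟩
  have h1 : deriv (fun v => eval (xs (μ, v)) (f₁ + μ.1 • g₂ + μ.2 • g₀)) (x k) = x k * s (μ, x k) :=
    (reduced_hasDerivAt_u hgrad hmem).deriv
  have h2 : eval (xs (μ, x k)) (pderiv k (f₁ + μ.1 • g₂ + μ.2 • g₀)) = x k * s (μ, x k) := hks _ hmem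
  rw [h1, ← h2, hxs]
  exact hk

/-- **Critical zero of the reduced function ⟹ singular point.**  If `(μ, u) ∈ D`, `r(μ, u) = 0` and `∂ᵤr(μ, u) = 0`, then
all partials of `F_μ` vanish at `xs(μ, u)`, a vector with `j`-coordinate `1` (so non-zero).
[cite: ArnoldGuseinzadeVarchenko2012, Part I §5.2] [cite: VoisinHodgeII2003, §2.1.1 Lemma 2.7] -/
theorem singular_of_critical (hf₁ : f₁.IsHomogeneous d) (hg₀ : g₀.IsHomogeneous d) (hg₂ : g₂.IsHomogeneous d)
    (hD : IsSymmetricA3Datum f₁ g₀ g₂ j k a)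
    (hchart : ∀ p ∈ D, xs p j = 1 ∧ xs p k = p.2 ∧
      ∀ i, i ≠ j → i ≠ k → eval (xs p) (pderiv i (f₁ + p.1.1 • g₂ + p.1.2 • g₀)) = 0)
    (hks : ∀ p ∈ D, eval (xs p) (pderiv k (f₁ + p.1.1 • g₂ + p.1.2 • g₀)) = p.2 * s p)
    (hgrad : ∀ p ∈ D, HasFDerivAt (fun q : (ℂ × ℂ) × ℂ => eval (xs q) (f₁ + q.1.1 • g₂ + q.1.2 • g₀))
      (eval (xs p) g₂ • (ContinuousLinearMap.fst ℂ ℂ ℂ).comp (ContinuousLinearMap.fst ℂ (ℂ × ℂ) ℂ) +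
        eval (xs p) g₀ • (ContinuousLinearMap.snd ℂ ℂ ℂ).comp (ContinuousLinearMap.fst ℂ (ℂ × ℂ) ℂ) +
        (p.2 * s p) • ContinuousLinearMap.snd ℂ (ℂ × ℂ) ℂ) p)
    {μ : ℂ × ℂ} {u : ℂ} (hp : (μ, u) ∈ D) (hzero : eval (xs (μ, u)) (f₁ + μ.1 • g₂ + μ.2 • g₀) = 0)
    (hcrit : deriv (fun v => eval (xs (μ, v)) (f₁ + μ.1 • g₂ + μ.2 • g₀)) u = 0) :
    (∀ i, eval (xs (μ, u)) (pderiv i (f₁ + μ.1 • g₂ + μ.2 • g₀)) = 0) ∧ xs (μ, u) j = 1 ∧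
      eval (xs (μ, u)) (pderiv k (f₁ + μ.1 • g₂ + μ.2 • g₀)) = 0 := by
  have hF : (f₁ + μ.1 • g₂ + μ.2 • g₀).IsHomogeneous d := by
    rw [MvPolynomial.smul_eq_C_mul, MvPolynomial.smul_eq_C_mul]
    exact (hf₁.add (hg₂.C_mul _)).add (hg₀.C_mul _)
  have hd : d ≠ 0 := by have := hD.one_le hf₁; omega
  obtain ⟨hxj, -, hpart⟩ := hchart _ hp
  have hxj' : xs (μ, u) j = 1 := hxj
  have hpart' : ∀ i, i ≠ j → i ≠ k → eval (xs (μ, u)) (pderiv i (f₁ + μ.1 • g₂ + μ.2 • g₀)) = 0 :=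
    fun i hij hik => hpart i hij hik
  have hk : eval (xs (μ, u)) (pderiv k (f₁ + μ.1 • g₂ + μ.2 • g₀)) = 0 := by
    have h1 : deriv (fun v => eval (xs (μ, v)) (f₁ + μ.1 • g₂ + μ.2 • g₀)) u = u * s (μ, u) :=
      (reduced_hasDerivAt_u hgrad hp).deriv
    have h2 : eval (xs (μ, u)) (pderiv k (f₁ + μ.1 • g₂ + μ.2 • g₀)) = u * s (μ, u) := hks _ hp
    rw [h2, ← h1]
    exact hcrit
  have hall : ∀ i, eval (xs (μ, u)) (pderiv i (f₁ + μ.1 • g₂ + μ.2 • g₀)) = 0 :=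
    (slice_singular_iff hF hd hD.1 hxj' hpart').2 ⟨hzero, hk⟩
  exact ⟨hall, hxj', hk⟩

/-- **A critical zero with `∂ᵤ²r ≠ 0` and non-degenerate Hessian block is an ordinary double point.**
[cite: ArnoldGuseinzadeVarchenko2012, Part I §5.2] [cite: VoisinHodgeII2003, §2.1.1 Lemma 2.7, Cor. 2.8] -/
theorem isOrdinaryDoublePointOf_of_critical (hf₁ : f₁.IsHomogeneous d) (hg₀ : g₀.IsHomogeneous d)
    (hg₂ : g₂.IsHomogeneous d) (hD : IsSymmetricA3Datum f₁ g₀ g₂ j k a) (hDo : IsOpen D)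
    (hxs : DifferentiableOn ℂ xs D)
    (hchart : ∀ p ∈ D, xs p j = 1 ∧ xs p k = p.2 ∧
      ∀ i, i ≠ j → i ≠ k → eval (xs p) (pderiv i (f₁ + p.1.1 • g₂ + p.1.2 • g₀)) = 0)
    (hks : ∀ p ∈ D, eval (xs p) (pderiv k (f₁ + p.1.1 • g₂ + p.1.2 • g₀)) = p.2 * s p)
    (hgrad : ∀ p ∈ D, HasFDerivAt (fun q : (ℂ × ℂ) × ℂ => eval (xs q) (f₁ + q.1.1 • g₂ + q.1.2 • g₀))
      (eval (xs p) g₂ • (ContinuousLinearMap.fst ℂ ℂ ℂ).comp (ContinuousLinearMap.fst ℂ (ℂ × ℂ) ℂ) +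
        eval (xs p) g₀ • (ContinuousLinearMap.snd ℂ ℂ ℂ).comp (ContinuousLinearMap.fst ℂ (ℂ × ℂ) ℂ) +
        (p.2 * s p) • ContinuousLinearMap.snd ℂ (ℂ × ℂ) ℂ) p)
    {μ : ℂ × ℂ} {u : ℂ} (hp : (μ, u) ∈ D) (hzero : eval (xs (μ, u)) (f₁ + μ.1 • g₂ + μ.2 • g₀) = 0)
    (hcrit : deriv (fun v => eval (xs (μ, v)) (f₁ + μ.1 • g₂ + μ.2 • g₀)) u = 0)
    (hblock : ((hessianAt (f₁ + μ.1 • g₂ + μ.2 • g₀) (xs (μ, u))).submatrix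
      (fun i : {i : Fin (n + 2) // i ≠ j ∧ i ≠ k} => i.1) (fun i : {i : Fin (n + 2) // i ≠ j ∧ i ≠ k} => i.1)).det ≠ 0)
    (hsecond : iteratedDeriv 2 (fun v => eval (xs (μ, v)) (f₁ + μ.1 • g₂ + μ.2 • g₀)) u ≠ 0) :
    IsOrdinaryDoublePointOf (f₁ + μ.1 • g₂ + μ.2 • g₀) (xs (μ, u)) := by
  obtain ⟨-, -, hk⟩ := singular_of_critical hf₁ hg₀ hg₂ hD hchart hks hgrad hp hzero hcrit
  have hschur' : deriv (fun v => eval (xs (μ, v)) (pderiv k (f₁ + μ.1 • g₂ + μ.2 • g₀))) u ≠ 0 := by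
    rw [← reduced_iteratedDeriv_two hDo hks hgrad hp]
    exact hsecond
  -- the hypotheses of `isOrdinaryDoublePointOf_chart` in its own spelling `p = (μ, u)`
  have hzero' : eval (xs (μ, u)) (f₁ + (μ, u).1.1 • g₂ + (μ, u).1.2 • g₀) = 0 := by
    simpa only using hzero
  have hk' : eval (xs (μ, u)) (pderiv k (f₁ + (μ, u).1.1 • g₂ + (μ, u).1.2 • g₀)) = 0 := by
    simpa only using hk
  have hblock' : ((hessianAt (f₁ + (μ, u).1.1 • g₂ + (μ, u).1.2 • g₀) (xs (μ, u))).submatrix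
      (fun i : {i : Fin (n + 2) // i ≠ j ∧ i ≠ k} => i.1) (fun i : {i : Fin (n + 2) // i ≠ j ∧ i ≠ k} => i.1)).det ≠ 0 := by
    simpa only using hblock
  have hschur : deriv (fun v => eval (xs ((μ, u).1, v)) (pderiv k (f₁ + (μ, u).1.1 • g₂ + (μ, u).1.2 • g₀)))
      (μ, u).2 ≠ 0 := by
    simpa only using hschur'
  have h := isOrdinaryDoublePointOf_chart hf₁ hg₀ hg₂ hD hDo hxs hchart hp hzero' hk' hblock' hschur
  simpa only using h

end IsSymmetricA3Datum

end HodgeTheory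

end Literature.AlgebraicGeometry.HodgeTheory

end
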